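import Literature.NumberTheory.ConnesConsani2021.ProlateDerivativeParseval
import Literature.NumberTheory.ConnesConsani2021.ProlateEigenvalueTailMass
import HarnessLib

/-!
# Finite-rank truncation of the cosine kernel: `‖k − Σ_{n<N} λ(n) e_n⊗e_n‖²_{HS} = Λ − Σ_{n<N} λ(n)²`
# and its `∂_x` companion (the two Cauchy–Schwarz inputs of the (ii)-FULL tail regrouping)

LINE 1 — FRAMING: RH-FREE classical analysis (Hilbert–Schmidt norms of explicit integral kernels on
`L²((0,1])` in Slepian's even prolate basis); cell rh-crit, corpus C1, seat t2 (self-deal D2, board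
11:4xZ: insurance for §2(a) of seat t7's fallback spec `cc/drafts/t7-K3-tail-ii-FULL.md`, whose §1 is the
tree after p433310/p440026/p442028).  bears_on: W-C/W-P — K3 `WindowSpectralBound` (stmt 19306), (E-a)
high-mode tail, design (ii)-FULL (documented fallback; primary = (iv)).  WHAT THIS IS NOT: a certificate,
a tail bound with numerals, or any claim about RH — nothing here mentions `ζ`, the critical strip or RH,
and nothing here bears on the truth of RH.

Source: A. Connes, C. Consani, *Weil positivity and trace formula, the archimedean place*, Selecta Math.
(N.S.) 27 (2021) 77 = arXiv:2006.13771 [bib `ConnesConsani2021`]: Remark 4.6 (i) §4 p. 18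
(`Tr(𝒫̂₁𝒫₁) = Σλ(n)² = δ(1)`), Prop. 4.5 (ii) p. 17 (the `ξ_n` are an orthonormal basis of `𝒫₁L²(ℝ)_ev`),
§4 p. 16 eq. (74)/(cosalphan), §5 p. 32 (`η_n = λ(n)ξ_n^{an}`); the Hilbert–Schmidt identity
[Bump 1997, Thm. 2.3.2] (tree `hasSum_integral_norm_sq_integral_kernel_mul`).

## What is here (theorems only: 0 definitions, 0 named facts)

In the `L²((0,1])` model of `ProlateTraceIdentities.lean` (`e_n = √2ψ_n|_{(0,1]}` a Hilbert basis by
`CC2021_sec4_xi_complete_holds`; the cosine operator has kernel `2cos(2πtx)` and `T e_n = λ(n)e_n`):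

* `setIntegral_setIntegral_sq_cosKernel_sub_sum (N)` —
  `∫_{(0,1]}∫_{(0,1]} (2cos(2πtx) − Σ_{n<N} 2λ(n)ψ_n(x)ψ_n(t))² dt dx = Λ − Σ_{n<N} λ(n)²`,
  `Λ = 2(Si(4π)/(4π)+1)`: the truncated kernel `K_N` acts as `e_m ↦ [m ≥ N]λ(m)e_m`, so its
  Hilbert–Schmidt norm is the tail `Σ_{m≥N}λ(m)²` (`hasSum_sq_prolateEigen_compl`, `ProlateEigenvalueTailMass`);
* `setIntegral_setIntegral_sq_sinMomentKernel_sub_sum (N)` — the `∂_x` companion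
  `∫_{(0,1]}∫_{(0,1]} (2(−2πt)sin(2πtx) − Σ_{n<N} 2λ(n)(ψ_n^{an})′(x)ψ_n(t))² dt dx
   = (8π²/3 + 1/2) − Σ_{n<N} λ(n)² ∫_{−1}^{1}((ψ_n^{an})′)²`
  (`T^{(1)} e_m = [m ≥ N]·√2λ(m)(ψ_m^{an})′`; total mass = (P4′) of `ProlateDerivativeParseval.lean`).
-/

noncomputable section

open Real MeasureTheory Set Filter Complex Finset
open scoped InnerProductSpace Topology

namespace Literature.NumberTheory.ConnesConsani2021

open Literature.NumberTheory.LFunctions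

/-! ## Small helpers: parity folds and orthonormality on `[0,1]` -/

/-- Folding an even integrand over `[−1,1]`: `∫_{−1}^{1} f = 2∫_0^1 f`. [folklore] -/
private theorem intervalIntegral_eq_two_mul_of_even' {f : ℝ → ℝ} (hf : ∀ x, f (-x) = f x)
    (h1 : IntervalIntegrable f volume (-1) 0) (h2 : IntervalIntegrable f volume 0 1) :
    ∫ x in (-1 : ℝ)..1, f x = 2 * ∫ x in (0 : ℝ)..1, f x := by
  rw [← intervalIntegral.integral_add_adjacent_intervals h1 h2, two_mul]
  congr 1
  have h := intervalIntegral.integral_comp_neg (a := (0 : ℝ)) (b := 1) f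
  rw [neg_zero] at h
  rw [← h]
  exact intervalIntegral.integral_congr fun x _ ↦ hf x

/-- `ψ_n` is continuous on `[−1,1]`. [cite: ConnesConsani2021, Prop. 4.5 (i) §4 p. 16 (arXiv p0016:L50)] -/
private theorem continuousOn_prolateFun' (n : ℕ) : ContinuousOn (prolateFun n) (Icc (-1 : ℝ) 1) :=
  (isProlateFunction_prolateFun n).contDiffOn.continuousOn

/-- `∫_{−1}^{1} ψ_nψ_m = δ_{nm}`. [cite: ConnesConsani2021, Prop. 4.5 (ii)–(iii) §4 pp. 16–17 (arXiv p0017:L2)] -/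
private theorem intervalIntegral_prolateFun_mul (n m : ℕ) :
    ∫ x in (-1 : ℝ)..1, prolateFun n x * prolateFun m x = if n = m then 1 else 0 := by
  have h := inner_prolateXi n m
  rw [inner_prolateXi_eq_ite] at h
  split_ifs at h with hnm
  · rw [if_pos hnm]; exact_mod_cast h.symm
  · rw [if_neg hnm]; exact_mod_cast h.symm

/-- `∫_0^1 ψ_nψ_m = δ_{nm}/2` (evenness). [cite: ConnesConsani2021, Prop. 4.5 (ii)–(iii) §4 pp. 16–17 (arXiv p0017:L2)] -/
private theorem integral_half_prolateFun_mul (n m : ℕ) :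
    ∫ x in (0 : ℝ)..1, prolateFun n x * prolateFun m x = (if n = m then 1 else 0) / 2 := by
  have hc : ContinuousOn (fun x ↦ prolateFun n x * prolateFun m x) (Icc (-1 : ℝ) 1) :=
    (continuousOn_prolateFun' n).mul (continuousOn_prolateFun' m)
  have h := intervalIntegral_eq_two_mul_of_even' (f := fun x ↦ prolateFun n x * prolateFun m x)
    (fun x ↦ by simp only [prolateFun_neg])
    ((hc.mono (Icc_subset_Icc le_rfl zero_le_one)).intervalIntegrable_of_Icc (by norm_num))
    ((hc.mono (Icc_subset_Icc (by norm_num) le_rfl)).intervalIntegrable_of_Icc zero_le_one)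
  rw [intervalIntegral_prolateFun_mul] at h
  linarith

/-- `∫_0^1 ψ_n^{an}ψ_m = δ_{nm}/2` (`ψ_n^{an} = ψ_n` on `[0,1]`). [cite: ConnesConsani2021, §5 p. 32 (ξ_n^{an} = ξ_n on [−1,1]); Prop. 4.5 (ii) p. 17] -/
private theorem integral_half_prolateFunAn_mul (n m : ℕ) :
    ∫ x in (0 : ℝ)..1, prolateFunAn n x * prolateFun m x = (if n = m then 1 else 0) / 2 := by
  rw [← integral_half_prolateFun_mul]
  refine intervalIntegral.integral_congr fun x hx ↦ ?_
  rw [Set.uIcc_of_le zero_le_one] at hx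
  show prolateFunAn n x * prolateFun m x = prolateFun n x * prolateFun m x
  rw [prolateFunAn_eq_prolateFun ⟨by linarith [hx.1], hx.2⟩]

/-- `∫_0^1 2cos(2πtx)ψ_m(t) dt = η̃_m(x) = λ(m)ψ_m^{an}(x)` for every real `x` (evenness + (74)).
[cite: ConnesConsani2021, §4 p. 16 eq. (74)/(cosalphan); §5 p. 32 (η_n = λ(n)ξ_n^{an})] -/
private theorem integral_half_two_cos_mul (m : ℕ) (x : ℝ) :
    ∫ t in (0 : ℝ)..1, 2 * Real.cos (2 * π * t * x) * prolateFun m t =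
      prolateEigen m * prolateFunAn m x := by
  have hc : ContinuousOn (fun t ↦ prolateFun m t * Real.cos (2 * π * t * x)) (Icc (-1 : ℝ) 1) :=
    (continuousOn_prolateFun' m).mul (by fun_prop : Continuous fun t : ℝ ↦
      Real.cos (2 * π * t * x)).continuousOn
  have h := intervalIntegral_eq_two_mul_of_even' (f := fun t ↦ prolateFun m t * Real.cos (2 * π * t * x))
    (fun t ↦ by
      simp only [prolateFun_neg]
      rw [show 2 * π * -t * x = -(2 * π * t * x) by ring, Real.cos_neg])
    ((hc.mono (Icc_subset_Icc le_rfl zero_le_one)).intervalIntegrable_of_Icc (by norm_num))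
    ((hc.mono (Icc_subset_Icc (by norm_num) le_rfl)).intervalIntegrable_of_Icc zero_le_one)
  have e : (fun t ↦ 2 * Real.cos (2 * π * t * x) * prolateFun m t) =
      fun t ↦ 2 * (prolateFun m t * Real.cos (2 * π * t * x)) := by
    funext t; ring
  rw [e, intervalIntegral.integral_const_mul, ← cosTransform_prolateFun_eq_mul_prolateFunAn, cosTransform]
  linarith

/-- `|ψ_n^{an}| ≤ (99/70)/|λ(n)|` on `ℝ`. [cite: ConnesConsani2021, §5 Lemma 5.4 proof (arXiv item 31, chunk p0020:L91–L98); §5 p. 32] -/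
private theorem abs_prolateFunAn_le (n : ℕ) (y : ℝ) :
    |prolateFunAn n y| ≤ 99 / 70 / |prolateEigen n| := by
  have h := abs_cosTransform_le (continuousOn_prolateFun' n) (isProlateFunction_prolateFun n).norm_one y
  have hl : 0 < |prolateEigen n| := abs_pos.2 (prolateEigen_ne_zero n)
  rw [prolateFunAn, abs_div]
  exact div_le_div_of_nonneg_right h hl.le

/-- A generic tail: from `HasSum f S`, the `m ≥ N` part sums to `S − Σ_{m<N} f m`. [folklore] -/
private theorem hasSum_ite_of_hasSum {f : ℕ → ℝ} {S : ℝ} (hf : HasSum f S) (N : ℕ) :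
    HasSum (fun m : ℕ ↦ if N ≤ m then f m else 0) (S - ∑ n ∈ Finset.range N, f n) := by
  have h2 : HasSum (fun m : ℕ ↦ if m < N then f m else 0) (∑ n ∈ Finset.range N, f n) := by
    have h : HasSum (fun m : ℕ ↦ if m < N then f m else 0)
        (∑ b ∈ Finset.range N, if b < N then f b else 0) :=
      hasSum_sum_of_ne_finset_zero (fun m hm ↦ if_neg (by simpa using hm))
    have e : (∑ b ∈ Finset.range N, if b < N then f b else 0) = ∑ b ∈ Finset.range N, f b :=
      Finset.sum_congr rfl (fun b hb ↦ if_pos (Finset.mem_range.1 hb))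
    rwa [e] at h
  have e : (fun m : ℕ ↦ if N ≤ m then f m else 0) = fun m ↦ f m - (if m < N then f m else 0) := by
    funext m
    by_cases hm : N ≤ m
    · rw [if_pos hm, if_neg (not_lt.2 hm), sub_zero]
    · rw [if_neg hm, if_pos (not_le.1 hm), sub_self]
  rw [e]
  exact hf.sub h2

/-- `Σ_{n∈range N} c_n · (δ_{nm}/2) = [m < N]·c_m/2`. [folklore] -/
private theorem sum_mul_ite_div_two (N m : ℕ) (c : ℕ → ℝ) :
    ∑ n ∈ Finset.range N, c n * ((if n = m then 1 else 0) / 2) = if m < N then c m / 2 else 0 := by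
  rw [Finset.sum_congr rfl (g := fun n ↦ if n = m then c n / 2 else 0) (fun n _ ↦ by
    split_ifs <;> ring), Finset.sum_ite_eq' (Finset.range N) m (fun n ↦ c n / 2)]
  simp only [Finset.mem_range]

/-! ## (D3a) The truncated cosine kernel -/

/-- **Finite-rank truncation error of the cosine kernel = the Hilbert–Schmidt tail**:
`∫_{(0,1]}∫_{(0,1]} (2cos(2πtx) − Σ_{n<N} 2λ(n)ψ_n(x)ψ_n(t))² dt dx = Λ − Σ_{n<N} λ(n)²`,
`Λ = 2(Si(4π)/(4π)+1) = Σ_n λ(n)²` (Remark 4.6 (i)).  In the Hilbert basis `e_n = √2ψ_n|_{(0,1]}` of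
`L²((0,1])` the truncated kernel acts as `e_m ↦ [m ≥ N]·λ(m)e_m`, and [Bump, Thm. 2.3.2] sums the squares.
[cite: ConnesConsani2021, Remark 4.6 (i) §4 p. 18 (arXiv item Remark 26, p0018:L2–L5, L20–L30); Prop. 4.5 (ii) p. 17; §4 p. 16 eq. (74)/(cosalphan); Bump1997, Ch. 2 §2.3 Thm. 2.3.2] -/
theorem setIntegral_setIntegral_sq_cosKernel_sub_sum (N : ℕ) :
    ∫ x in Ioc (0 : ℝ) 1, ∫ t in Ioc (0 : ℝ) 1,
      (2 * Real.cos (2 * π * t * x) -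
        ∑ n ∈ Finset.range N, 2 * prolateEigen n * (prolateFun n x * prolateFun n t)) ^ 2 =
    2 * (sinIntegral (4 * π) / (4 * π) + 1) - ∑ n ∈ Finset.range N, prolateEigen n ^ 2 := by
  haveI : IsFiniteMeasure ((volume : Measure ℝ).restrict (Ioc (0 : ℝ) 1)) :=
    isFiniteMeasure_restrict.2 measure_Ioc_lt_top.ne
  set b : HilbertBasis ℕ ℂ (Lp ℂ 2 ((volume : Measure ℝ).restrict (Ioc (0 : ℝ) 1))) :=
    HilbertBasis.mkOfOrthogonalEqBot orthonormal_toLp_sqrt_two_mul_prolateXiFun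
      (orthogonal_span_toLp_sqrt_two_mul_prolateXiFun_eq_bot CC2021_sec4_xi_complete_holds) with hbdef
  have hb : ∀ n : ℕ, (b n : Lp ℂ 2 ((volume : Measure ℝ).restrict (Ioc (0 : ℝ) 1)))
      = (memLp_sqrt_two_mul_prolateXiFun_restrict n).toLp _ := fun n ↦ by
    rw [hbdef, HilbertBasis.coe_mkOfOrthogonalEqBot]
  -- the kernel, written with the analytic continuations `ψ_n^{an}` (continuous on `ℝ`, `= ψ_n` on `(0,1]`)
  set K : ℝ → ℝ → ℂ := fun x t ↦ ((2 * Real.cos (2 * π * t * x) -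
    ∑ n ∈ Finset.range N, 2 * prolateEigen n * (prolateFunAn n x * prolateFunAn n t) : ℝ) : ℂ) with hKdef
  have hK : StronglyMeasurable (Function.uncurry K) := by
    apply Continuous.stronglyMeasurable
    have hc : Continuous fun p : ℝ × ℝ ↦ (2 * Real.cos (2 * π * p.2 * p.1) -
        ∑ n ∈ Finset.range N, 2 * prolateEigen n * (prolateFunAn n p.1 * prolateFunAn n p.2)) := by
      refine Continuous.sub (by fun_prop) (continuous_finsetSum _ fun n _ ↦ ?_)
      exact continuous_const.mul (((continuous_prolateFunAn n).comp continuous_fst).mul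
        ((continuous_prolateFunAn n).comp continuous_snd))
    exact Complex.continuous_ofReal.comp hc
  -- a global bound
  set C : ℝ := 2 + ∑ n ∈ Finset.range N, 2 * |prolateEigen n| * (99 / 70 / |prolateEigen n|) ^ 2
    with hCdef
  have hC : ∀ x t, ‖K x t‖ ≤ C := fun x t ↦ by
    simp only [hKdef, Complex.norm_real, Real.norm_eq_abs]
    refine (abs_sub _ _).trans (add_le_add ?_ ((Finset.abs_sum_le_sum_abs _ _).trans
      (Finset.sum_le_sum fun n _ ↦ ?_)))
    · rw [abs_mul, abs_two]
      have := Real.abs_cos_le_one (2 * π * t * x)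
      linarith
    · rw [abs_mul, abs_mul, abs_mul, abs_two, sq]
      have h1 := abs_prolateFunAn_le n x
      have h2 := abs_prolateFunAn_le n t
      have h0 : 0 ≤ |prolateFunAn n x| := abs_nonneg _
      have h0' : 0 ≤ |prolateFunAn n t| := abs_nonneg _
      gcongr
  have hs := Literature.Analysis.OperatorTheory.hasSum_integral_norm_sq_integral_kernel_mul hK hC b
  -- `T_K e_m = √2·[m ≥ N]·λ(m)ψ_m^{an}`
  have hinner : ∀ (m : ℕ) (x : ℝ), ∫ t, K x t * b m t ∂((volume : Measure ℝ).restrict (Ioc (0 : ℝ) 1)) =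
      ((Real.sqrt 2 * (if N ≤ m then prolateEigen m * prolateFunAn m x else 0) : ℝ) : ℂ) := by
    intro m x
    -- the real integrand
    have e1 : ∫ t, K x t * b m t ∂((volume : Measure ℝ).restrict (Ioc (0 : ℝ) 1)) =
        ∫ t in Ioc (0 : ℝ) 1, ((Real.sqrt 2 * ((2 * Real.cos (2 * π * t * x) -
          ∑ n ∈ Finset.range N, 2 * prolateEigen n * (prolateFunAn n x * prolateFunAn n t)) *
            prolateFun m t) : ℝ) : ℂ) := by
      refine integral_congr_ae ?_
      rw [hb m]
      filter_upwards [(memLp_sqrt_two_mul_prolateXiFun_restrict m).coeFn_toLp] with t ht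
      rw [ht]
      simp only [hKdef, prolateXiFun]
      push_cast
      ring
    -- interval integrability of the pieces on `[0,1]`
    have hIcos : IntervalIntegrable (fun t ↦ 2 * Real.cos (2 * π * t * x) * prolateFun m t) volume 0 1 := by
      refine ContinuousOn.intervalIntegrable_of_Icc zero_le_one ?_
      exact ((by fun_prop : Continuous fun t : ℝ ↦ 2 * Real.cos (2 * π * t * x)).continuousOn).mul
        ((continuousOn_prolateFun' m).mono (Icc_subset_Icc (by norm_num) le_rfl))
    have hIn : ∀ n ∈ Finset.range N, IntervalIntegrable
        (fun t ↦ 2 * prolateEigen n * prolateFunAn n x * (prolateFunAn n t * prolateFun m t)) volume 0 1 := by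
      intro n _
      refine ContinuousOn.intervalIntegrable_of_Icc zero_le_one ?_
      exact continuousOn_const.mul (((continuous_prolateFunAn n).continuousOn).mul
        ((continuousOn_prolateFun' m).mono (Icc_subset_Icc (by norm_num) le_rfl)))
    have e2 : ∫ t in (0 : ℝ)..1, (2 * Real.cos (2 * π * t * x) -
        ∑ n ∈ Finset.range N, 2 * prolateEigen n * (prolateFunAn n x * prolateFunAn n t)) * prolateFun m t =
        prolateEigen m * prolateFunAn m x -
          (if m < N then 2 * prolateEigen m * prolateFunAn m x / 2 else 0) := by
      have e : (fun t ↦ (2 * Real.cos (2 * π * t * x) -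
          ∑ n ∈ Finset.range N, 2 * prolateEigen n * (prolateFunAn n x * prolateFunAn n t)) * prolateFun m t) =
          fun t ↦ 2 * Real.cos (2 * π * t * x) * prolateFun m t -
            ∑ n ∈ Finset.range N, 2 * prolateEigen n * prolateFunAn n x * (prolateFunAn n t * prolateFun m t) := by
        funext t
        rw [sub_mul, Finset.sum_mul]
        congr 1
        exact Finset.sum_congr rfl fun n _ ↦ by ring
      have hIsum : IntervalIntegrable (fun t ↦ ∑ n ∈ Finset.range N,
          2 * prolateEigen n * prolateFunAn n x * (prolateFunAn n t * prolateFun m t)) volume 0 1 := by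
        refine ContinuousOn.intervalIntegrable_of_Icc zero_le_one ?_
        refine continuousOn_finsetSum _ fun n _ ↦ ?_
        exact continuousOn_const.mul (((continuous_prolateFunAn n).continuousOn).mul
          ((continuousOn_prolateFun' m).mono (Icc_subset_Icc (by norm_num) le_rfl)))
      rw [e, intervalIntegral.integral_sub hIcos hIsum,
        intervalIntegral.integral_finsetSum hIn, integral_half_two_cos_mul,
        ← sum_mul_ite_div_two N m (fun n ↦ 2 * prolateEigen n * prolateFunAn n x)]
      congr 1
      refine Finset.sum_congr rfl fun n _ ↦ ?_
      rw [intervalIntegral.integral_const_mul, integral_half_prolateFunAn_mul]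
    rw [e1, integral_complex_ofReal, ← intervalIntegral.integral_of_le zero_le_one,
      intervalIntegral.integral_const_mul, e2]
    congr 1
    by_cases hm : N ≤ m
    · rw [if_pos hm, if_neg (not_lt.2 hm)]; ring
    · rw [if_neg hm, if_pos (not_le.1 hm)]; ring
  -- `‖T_K e_m‖² = [m ≥ N]·λ(m)²`
  have hterm : ∀ m : ℕ,
      ∫ x, ‖∫ t, K x t * b m t ∂((volume : Measure ℝ).restrict (Ioc (0 : ℝ) 1))‖ ^ 2
        ∂((volume : Measure ℝ).restrict (Ioc (0 : ℝ) 1)) = if N ≤ m then prolateEigen m ^ 2 else 0 := by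
    intro m
    by_cases hm : N ≤ m
    · have e2 : (fun x ↦ ‖∫ t, K x t * b m t ∂((volume : Measure ℝ).restrict (Ioc (0 : ℝ) 1))‖ ^ 2) =
          fun x ↦ 2 * prolateEigen m ^ 2 * (prolateFunAn m x * prolateFunAn m x) := by
        funext x
        rw [hinner m x, if_pos hm, Complex.norm_real, Real.norm_eq_abs, sq_abs, mul_pow,
          Real.sq_sqrt zero_le_two]
        ring
      rw [if_pos hm, e2, ← intervalIntegral.integral_of_le zero_le_one, intervalIntegral.integral_const_mul,
        intervalIntegral.integral_congr (g := fun x ↦ prolateFunAn m x * prolateFun m x) (fun x hx ↦ by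
          rw [Set.uIcc_of_le zero_le_one] at hx
          show prolateFunAn m x * prolateFunAn m x = prolateFunAn m x * prolateFun m x
          rw [prolateFunAn_eq_prolateFun ⟨by linarith [hx.1], hx.2⟩]),
        integral_half_prolateFunAn_mul, if_pos rfl]
      ring
    · have e2 : (fun x ↦ ‖∫ t, K x t * b m t ∂((volume : Measure ℝ).restrict (Ioc (0 : ℝ) 1))‖ ^ 2) =
          fun x ↦ (0 : ℝ) := by
        funext x
        rw [hinner m x, if_neg hm, mul_zero, Complex.ofReal_zero, norm_zero, zero_pow two_ne_zero]
      rw [if_neg hm, e2, integral_zero]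
  -- the Hilbert–Schmidt identity and the value
  have hval : ∫ x, ∫ t, ‖K x t‖ ^ 2 ∂((volume : Measure ℝ).restrict (Ioc (0 : ℝ) 1))
      ∂((volume : Measure ℝ).restrict (Ioc (0 : ℝ) 1)) =
      2 * (sinIntegral (4 * π) / (4 * π) + 1) - ∑ n ∈ Finset.range N, prolateEigen n ^ 2 := by
    have h1 : HasSum (fun m : ℕ ↦ if N ≤ m then prolateEigen m ^ 2 else 0)
        (∫ x, ∫ t, ‖K x t‖ ^ 2 ∂((volume : Measure ℝ).restrict (Ioc (0 : ℝ) 1))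
          ∂((volume : Measure ℝ).restrict (Ioc (0 : ℝ) 1))) := by
      convert hs using 1
      funext m
      exact (hterm m).symm
    exact h1.unique (hasSum_ite_of_hasSum hasSum_prolateEigen_sq_sinIntegral N)
  -- back to `ψ_n` on `(0,1]²`
  rw [← hval]
  refine setIntegral_congr_fun measurableSet_Ioc fun x hx ↦ ?_
  refine setIntegral_congr_fun measurableSet_Ioc fun t ht ↦ ?_
  simp only [hKdef, Complex.norm_real, Real.norm_eq_abs, sq_abs,
    prolateFunAn_eq_prolateFun ⟨by linarith [hx.1], hx.2⟩,
    prolateFunAn_eq_prolateFun ⟨by linarith [ht.1], ht.2⟩]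

/-! ## (D3b) The truncated sine-moment kernel (`∂_x` of the cosine kernel) -/

/-- `∫_0^1 2(−2πt)sin(2πtx)ψ_m(t) dt = η̃_m′(x) = λ(m)(ψ_m^{an})′(x)` for every real `x` (evenness fold of the
tree's `deriv_cosTransform`). [cite: ConnesConsani2021, App. F (arXiv chunk p0035:L55); §5 p. 32] -/
private theorem integral_half_two_sinMoment_mul (m : ℕ) (x : ℝ) :
    ∫ t in (0 : ℝ)..1, 2 * (-(2 * π * t) * Real.sin (2 * π * t * x)) * prolateFun m t =
      prolateEigen m * deriv (prolateFunAn m) x := by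
  have hψI : IntervalIntegrable (prolateFun m) volume (-1) 1 := by
    apply ContinuousOn.intervalIntegrable
    rw [Set.uIcc_of_le (by norm_num : (-1 : ℝ) ≤ 1)]
    exact continuousOn_prolateFun' m
  have hcont : ContinuousOn (fun t ↦ prolateFun m t * (-(2 * π * t) * Real.sin (2 * π * t * x)))
      (Icc (-1 : ℝ) 1) :=
    (continuousOn_prolateFun' m).mul (by fun_prop : Continuous fun t : ℝ ↦
      -(2 * π * t) * Real.sin (2 * π * t * x)).continuousOn
  have h := intervalIntegral_eq_two_mul_of_even'
    (f := fun t ↦ prolateFun m t * (-(2 * π * t) * Real.sin (2 * π * t * x)))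
    (fun t ↦ by
      simp only [prolateFun_neg]
      rw [show 2 * π * -t * x = -(2 * π * t * x) by ring, Real.sin_neg]
      ring)
    ((hcont.mono (Icc_subset_Icc le_rfl zero_le_one)).intervalIntegrable_of_Icc (by norm_num))
    ((hcont.mono (Icc_subset_Icc (by norm_num) le_rfl)).intervalIntegrable_of_Icc zero_le_one)
  have e : (fun t ↦ 2 * (-(2 * π * t) * Real.sin (2 * π * t * x)) * prolateFun m t) =
      fun t ↦ 2 * (prolateFun m t * (-(2 * π * t) * Real.sin (2 * π * t * x))) := by
    funext t; ring
  rw [e, intervalIntegral.integral_const_mul, ← deriv_cosTransform_prolateFun_eq,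
    congrFun (deriv_cosTransform hψI) x]
  linarith

/-- `∫_{−1}^{1} ((ψ_n^{an})′)² = 2∫_0^1 ((ψ_n^{an})′)²`. [cite: ConnesConsani2021, §4 p. 16 (even prolate functions); §5 p. 32] -/
private theorem integral_sq_deriv_prolateFunAn_eq_two_mul' (n : ℕ) :
    ∫ y in (-1 : ℝ)..1, deriv (prolateFunAn n) y ^ 2 = 2 * ∫ y in (0 : ℝ)..1, deriv (prolateFunAn n) y ^ 2 := by
  have hc : Continuous fun y ↦ deriv (prolateFunAn n) y ^ 2 := (continuous_deriv_prolateFunAn n).pow 2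
  exact intervalIntegral_eq_two_mul_of_even' (f := fun y ↦ deriv (prolateFunAn n) y ^ 2)
    (fun y ↦ by simp only [deriv_prolateFunAn_neg, neg_sq]) (hc.intervalIntegrable _ _)
    (hc.intervalIntegrable _ _)

/-- `|(ψ_n^{an})′| ≤ (99π/35)/|λ(n)|` on `ℝ`. [cite: ConnesConsani2021, App. F (arXiv chunk p0035:L53–L55: "|η_n′| ≤ 4π"); §5 p. 32] -/
private theorem abs_deriv_prolateFunAn_le (n : ℕ) (y : ℝ) :
    |deriv (prolateFunAn n) y| ≤ 99 * π / 35 / |prolateEigen n| := by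
  have h := abs_deriv_cosTransform_le (continuousOn_prolateFun' n)
    (isProlateFunction_prolateFun n).norm_one y
  have hl : 0 < |prolateEigen n| := abs_pos.2 (prolateEigen_ne_zero n)
  rw [deriv_prolateFunAn, abs_mul, abs_inv, inv_mul_eq_div]
  exact div_le_div_of_nonneg_right h hl.le

/-- **Finite-rank truncation of the `∂_x`-kernel**:
`∫_{(0,1]}∫_{(0,1]} (2(−2πt)sin(2πtx) − Σ_{n<N} 2λ(n)(ψ_n^{an})′(x)ψ_n(t))² dt dx
 = (8π²/3 + 1/2) − Σ_{n<N} λ(n)²∫_{−1}^{1}((ψ_n^{an})′)²`: the truncated kernel acts as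
`e_m ↦ [m ≥ N]·√2λ(m)(ψ_m^{an})′`, [Bump, Thm. 2.3.2] sums the squares, and the total mass is the
integrated derivative-Parseval identity `hasSum_sq_prolateEigen_mul_integral_sq_deriv_prolateFunAn`.
[cite: ConnesConsani2021, Remark 4.6 (i) §4 p. 18 (arXiv item Remark 26; same road as `Σλ(n)² = δ(1)`); Prop. 4.5 (ii) p. 17; App. F (p0035:L55); §5 p. 32; Bump1997, Ch. 2 §2.3 Thm. 2.3.2] -/
theorem setIntegral_setIntegral_sq_sinMomentKernel_sub_sum (N : ℕ) :
    ∫ x in Ioc (0 : ℝ) 1, ∫ t in Ioc (0 : ℝ) 1,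
      (2 * (-(2 * π * t) * Real.sin (2 * π * t * x)) -
        ∑ n ∈ Finset.range N, 2 * prolateEigen n * (deriv (prolateFunAn n) x * prolateFun n t)) ^ 2 =
    (8 * π ^ 2 / 3 + 1 / 2) -
      ∑ n ∈ Finset.range N, prolateEigen n ^ 2 * ∫ y in (-1 : ℝ)..1, deriv (prolateFunAn n) y ^ 2 := by
  haveI : IsFiniteMeasure ((volume : Measure ℝ).restrict (Ioc (0 : ℝ) 1)) :=
    isFiniteMeasure_restrict.2 measure_Ioc_lt_top.ne
  set b : HilbertBasis ℕ ℂ (Lp ℂ 2 ((volume : Measure ℝ).restrict (Ioc (0 : ℝ) 1))) :=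
    HilbertBasis.mkOfOrthogonalEqBot orthonormal_toLp_sqrt_two_mul_prolateXiFun
      (orthogonal_span_toLp_sqrt_two_mul_prolateXiFun_eq_bot CC2021_sec4_xi_complete_holds) with hbdef
  have hb : ∀ n : ℕ, (b n : Lp ℂ 2 ((volume : Measure ℝ).restrict (Ioc (0 : ℝ) 1)))
      = (memLp_sqrt_two_mul_prolateXiFun_restrict n).toLp _ := fun n ↦ by
    rw [hbdef, HilbertBasis.coe_mkOfOrthogonalEqBot]
  -- the kernel: `t` clamped to `[−1,1]` in the unbounded factor, `ψ^{an}` for continuity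
  set K : ℝ → ℝ → ℂ := fun x t ↦ ((2 * (-(2 * π * max (-1) (min t 1)) * Real.sin (2 * π * t * x)) -
    ∑ n ∈ Finset.range N, 2 * prolateEigen n * (deriv (prolateFunAn n) x * prolateFunAn n t) : ℝ) : ℂ)
    with hKdef
  have hclamp : ∀ t ∈ Icc (-1 : ℝ) 1, max (-1) (min t 1) = t := fun t ht ↦ by
    rw [min_eq_left ht.2, max_eq_right ht.1]
  have hK : StronglyMeasurable (Function.uncurry K) := by
    apply Continuous.stronglyMeasurable
    have hc : Continuous fun p : ℝ × ℝ ↦ (2 * (-(2 * π * max (-1) (min p.2 1)) * Real.sin (2 * π * p.2 * p.1)) -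
        ∑ n ∈ Finset.range N, 2 * prolateEigen n * (deriv (prolateFunAn n) p.1 * prolateFunAn n p.2)) := by
      refine Continuous.sub (by fun_prop) (continuous_finsetSum _ fun n _ ↦ ?_)
      exact continuous_const.mul (((continuous_deriv_prolateFunAn n).comp continuous_fst).mul
        ((continuous_prolateFunAn n).comp continuous_snd))
    exact Complex.continuous_ofReal.comp hc
  set C : ℝ := 4 * π + ∑ n ∈ Finset.range N,
    2 * |prolateEigen n| * ((99 * π / 35 / |prolateEigen n|) * (99 / 70 / |prolateEigen n|)) with hCdef
  have hC : ∀ x t, ‖K x t‖ ≤ C := fun x t ↦ by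
    simp only [hKdef, Complex.norm_real, Real.norm_eq_abs]
    refine (abs_sub _ _).trans (add_le_add ?_ ((Finset.abs_sum_le_sum_abs _ _).trans
      (Finset.sum_le_sum fun n _ ↦ ?_)))
    · have h1 : |max (-1) (min t 1)| ≤ 1 :=
        abs_le.2 ⟨le_max_left _ _, max_le (by norm_num) (min_le_right _ _)⟩
      have h2 := Real.abs_sin_le_one (2 * π * t * x)
      rw [abs_mul, abs_mul, abs_neg, abs_mul, abs_of_pos (by positivity : (0 : ℝ) < 2 * π), abs_two]
      calc 2 * (2 * π * |max (-1) (min t 1)| * |Real.sin (2 * π * t * x)|) ≤ 2 * (2 * π * 1 * 1) := by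
            gcongr
        _ = 4 * π := by ring
    · rw [abs_mul, abs_mul, abs_mul, abs_two]
      have h1 := abs_deriv_prolateFunAn_le n x
      have h2 := abs_prolateFunAn_le n t
      have h0 : 0 ≤ |deriv (prolateFunAn n) x| := abs_nonneg _
      have h0' : 0 ≤ |prolateFunAn n t| := abs_nonneg _
      gcongr
  have hs := Literature.Analysis.OperatorTheory.hasSum_integral_norm_sq_integral_kernel_mul hK hC b
  -- `T_K e_m = √2·[m ≥ N]·λ(m)(ψ_m^{an})′`
  have hinner : ∀ (m : ℕ) (x : ℝ), ∫ t, K x t * b m t ∂((volume : Measure ℝ).restrict (Ioc (0 : ℝ) 1)) =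
      ((Real.sqrt 2 * (if N ≤ m then prolateEigen m * deriv (prolateFunAn m) x else 0) : ℝ) : ℂ) := by
    intro m x
    have e1 : ∫ t, K x t * b m t ∂((volume : Measure ℝ).restrict (Ioc (0 : ℝ) 1)) =
        ∫ t in Ioc (0 : ℝ) 1, ((Real.sqrt 2 * ((2 * (-(2 * π * t) * Real.sin (2 * π * t * x)) -
          ∑ n ∈ Finset.range N, 2 * prolateEigen n * (deriv (prolateFunAn n) x * prolateFunAn n t)) *
            prolateFun m t) : ℝ) : ℂ) := by
      refine integral_congr_ae ?_
      rw [hb m]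
      filter_upwards [(memLp_sqrt_two_mul_prolateXiFun_restrict m).coeFn_toLp,
        ae_restrict_mem measurableSet_Ioc] with t ht htI
      rw [ht]
      simp only [hKdef, prolateXiFun, hclamp t ⟨by linarith [htI.1], htI.2⟩]
      push_cast
      ring
    have hIsin : IntervalIntegrable
        (fun t ↦ 2 * (-(2 * π * t) * Real.sin (2 * π * t * x)) * prolateFun m t) volume 0 1 := by
      refine ContinuousOn.intervalIntegrable_of_Icc zero_le_one ?_
      exact ((by fun_prop : Continuous fun t : ℝ ↦
        2 * (-(2 * π * t) * Real.sin (2 * π * t * x))).continuousOn).mul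
        ((continuousOn_prolateFun' m).mono (Icc_subset_Icc (by norm_num) le_rfl))
    have hIn : ∀ n ∈ Finset.range N, IntervalIntegrable
        (fun t ↦ 2 * prolateEigen n * deriv (prolateFunAn n) x * (prolateFunAn n t * prolateFun m t))
          volume 0 1 := by
      intro n _
      refine ContinuousOn.intervalIntegrable_of_Icc zero_le_one ?_
      exact continuousOn_const.mul (((continuous_prolateFunAn n).continuousOn).mul
        ((continuousOn_prolateFun' m).mono (Icc_subset_Icc (by norm_num) le_rfl)))
    have hIsum : IntervalIntegrable (fun t ↦ ∑ n ∈ Finset.range N,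
        2 * prolateEigen n * deriv (prolateFunAn n) x * (prolateFunAn n t * prolateFun m t)) volume 0 1 := by
      refine ContinuousOn.intervalIntegrable_of_Icc zero_le_one ?_
      refine continuousOn_finsetSum _ fun n _ ↦ ?_
      exact continuousOn_const.mul (((continuous_prolateFunAn n).continuousOn).mul
        ((continuousOn_prolateFun' m).mono (Icc_subset_Icc (by norm_num) le_rfl)))
    have e2 : ∫ t in (0 : ℝ)..1, ((2 * (-(2 * π * t) * Real.sin (2 * π * t * x)) -
        ∑ n ∈ Finset.range N, 2 * prolateEigen n * (deriv (prolateFunAn n) x * prolateFunAn n t)) *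
          prolateFun m t) =
        prolateEigen m * deriv (prolateFunAn m) x -
          (if m < N then 2 * prolateEigen m * deriv (prolateFunAn m) x / 2 else 0) := by
      have e : (fun t ↦ ((2 * (-(2 * π * t) * Real.sin (2 * π * t * x)) -
          ∑ n ∈ Finset.range N, 2 * prolateEigen n * (deriv (prolateFunAn n) x * prolateFunAn n t)) *
            prolateFun m t)) =
          fun t ↦ 2 * (-(2 * π * t) * Real.sin (2 * π * t * x)) * prolateFun m t -
            ∑ n ∈ Finset.range N, 2 * prolateEigen n * deriv (prolateFunAn n) x *
              (prolateFunAn n t * prolateFun m t) := by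
        funext t
        rw [sub_mul, Finset.sum_mul]
        congr 1
        exact Finset.sum_congr rfl fun n _ ↦ by ring
      rw [e, intervalIntegral.integral_sub hIsin hIsum, intervalIntegral.integral_finsetSum hIn,
        integral_half_two_sinMoment_mul,
        ← sum_mul_ite_div_two N m (fun n ↦ 2 * prolateEigen n * deriv (prolateFunAn n) x)]
      congr 1
      refine Finset.sum_congr rfl fun n _ ↦ ?_
      rw [intervalIntegral.integral_const_mul, integral_half_prolateFunAn_mul]
    rw [e1, integral_complex_ofReal, ← intervalIntegral.integral_of_le zero_le_one,
      intervalIntegral.integral_const_mul, e2]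
    congr 1
    by_cases hm : N ≤ m
    · rw [if_pos hm, if_neg (not_lt.2 hm)]; ring
    · rw [if_neg hm, if_pos (not_le.1 hm)]; ring
  -- `‖T_K e_m‖² = [m ≥ N]·λ(m)²‖(ψ_m^{an})′‖²`
  have hterm : ∀ m : ℕ,
      ∫ x, ‖∫ t, K x t * b m t ∂((volume : Measure ℝ).restrict (Ioc (0 : ℝ) 1))‖ ^ 2
        ∂((volume : Measure ℝ).restrict (Ioc (0 : ℝ) 1)) =
      if N ≤ m then prolateEigen m ^ 2 * ∫ y in (-1 : ℝ)..1, deriv (prolateFunAn m) y ^ 2 else 0 := by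
    intro m
    by_cases hm : N ≤ m
    · have e2 : (fun x ↦ ‖∫ t, K x t * b m t ∂((volume : Measure ℝ).restrict (Ioc (0 : ℝ) 1))‖ ^ 2) =
          fun x ↦ 2 * prolateEigen m ^ 2 * deriv (prolateFunAn m) x ^ 2 := by
        funext x
        rw [hinner m x, if_pos hm, Complex.norm_real, Real.norm_eq_abs, sq_abs, mul_pow,
          Real.sq_sqrt zero_le_two, mul_pow]
        ring
      rw [if_pos hm, e2, ← intervalIntegral.integral_of_le zero_le_one, intervalIntegral.integral_const_mul,
        integral_sq_deriv_prolateFunAn_eq_two_mul']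
      ring
    · have e2 : (fun x ↦ ‖∫ t, K x t * b m t ∂((volume : Measure ℝ).restrict (Ioc (0 : ℝ) 1))‖ ^ 2) =
          fun x ↦ (0 : ℝ) := by
        funext x
        rw [hinner m x, if_neg hm, mul_zero, Complex.ofReal_zero, norm_zero, zero_pow two_ne_zero]
      rw [if_neg hm, e2, integral_zero]
  have hval : ∫ x, ∫ t, ‖K x t‖ ^ 2 ∂((volume : Measure ℝ).restrict (Ioc (0 : ℝ) 1))
      ∂((volume : Measure ℝ).restrict (Ioc (0 : ℝ) 1)) =
      (8 * π ^ 2 / 3 + 1 / 2) -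
        ∑ n ∈ Finset.range N, prolateEigen n ^ 2 * ∫ y in (-1 : ℝ)..1, deriv (prolateFunAn n) y ^ 2 := by
    have h1 : HasSum (fun m : ℕ ↦
        if N ≤ m then prolateEigen m ^ 2 * ∫ y in (-1 : ℝ)..1, deriv (prolateFunAn m) y ^ 2 else 0)
        (∫ x, ∫ t, ‖K x t‖ ^ 2 ∂((volume : Measure ℝ).restrict (Ioc (0 : ℝ) 1))
          ∂((volume : Measure ℝ).restrict (Ioc (0 : ℝ) 1))) := by
      convert hs using 1
      funext m
      exact (hterm m).symm
    exact h1.unique (hasSum_ite_of_hasSum hasSum_sq_prolateEigen_mul_integral_sq_deriv_prolateFunAn N)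
  rw [← hval]
  refine setIntegral_congr_fun measurableSet_Ioc fun x hx ↦ ?_
  refine setIntegral_congr_fun measurableSet_Ioc fun t ht ↦ ?_
  simp only [hKdef, Complex.norm_real, Real.norm_eq_abs, sq_abs,
    hclamp t ⟨by linarith [ht.1], ht.2⟩, prolateFunAn_eq_prolateFun ⟨by linarith [ht.1], ht.2⟩]

end Literature.NumberTheory.ConnesConsani2021

end
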